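/-
Copyright (c) 2026 the pub-hodgecm-mathlib formalisation cell (harness21).  Prover seat hodgecm-mathlib-K2E3-p17 (g6), Track B «K2-LIT» ∕ h413
(`stmt-HodgeConjecture-24833`), line `K2_E3_EllipticInputs`, unit U12 §L, Richardson road for (LBGL-ge3) at `N = 3` (road owner K2E3-p11 (g4)),
brick (F-J) = (S-B♭)_Lie, FILE G1 «WHO CONJUGATES A NEARBY DIAGONAL INTO THE CHART IMAGE».  2026-09-04.
-/
import Summits.HodgeConjecture.HodgeConjecture.Theorems.K2E3GL3OrbitChartDeriv            -- ★ p857621 (this seat, E1): `exists_orbitChart_eq_conj`, §1 algebra of the chart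
import Summits.HodgeConjecture.HodgeConjecture.Theorems.K2E3GLnLieAdIntegralInvariant   -- ★ (K2E3-p12): `glInt` kit, integer boxes
import Summits.HodgeConjecture.HodgeConjecture.Theorems.K2E3GL3BorelUnipotentHaar        -- ★ p857423 (K2E3-p11): `mem_borelUnipotentGL3_iff`
import Literature.NumberTheory.Automorphic.GLnUnipotentRadicalUnimodular                -- ★ `unipotentRadicalGL`, `standardLeviGL`, local unimodularity kit
import Literature.NumberTheory.Automorphic.LocalFieldHaarBalls                          -- ★ `primePowBall` kit, `normAbs_add_le_max` (via `AddCharConductorExponent`)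
import Literature.MeasureTheory.Group.HaarLocalChart                                    -- ★ `isMulRightInvariant_of_isHaarMeasure` (compact groups are unimodular)
import Literature.MeasureTheory.Group.LocalFieldGLnVolume                              -- ★ boxes `M₃(𝔭^k)`
import HarnessLib

/-!
# K2_E3 road (h413), §L ∕ Richardson road at `N = 3`, brick (F-J) FILE G1: who conjugates `s = diagonal (d + z)` into the chart image `V_k(t)` — the stabiliser
# bookkeeping behind the `K × N₃`-orbital pullback (FILE G2)

Cell `pub/hodgecm-mathlib` (D-0151), Track B, seat K2E3-p17 (g6), deal (D60) = (F-J) (road owner K2E3-p11 (g4); census `K2/K2E3-p17/g6/CENSUS-SBflatLie-N3.K2E3-p17-g6.md`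
§1 (iv), brick G).  `--supports stmt-HodgeConjecture-24833 --as helper`; THEOREMS ONLY (no definition ∕ instance ∕ notation ∕ named fact ∕ `sorry`); never imports
`Cruxes/…/Lines`.  COUNT-NEUTRAL.

THE MATHEMATICS ([HarishChandra1999AdmissibleDistributions] Lemma 7.8; [HarishChandra1970] Part V §4 Lemma 22).  `G = GL₃(F)`, `K = GL₃(𝒪)` (★ `glInt`), `N = N₃` (★ `unipotentRadicalGL F id`),
`A` the diagonal torus, `t = diagonal d` regular, `s = diagonal (d + z)` with `z ∈ (𝔭^k)³`, `V_k(t) = Ψ_t(M₃(𝔭^k))` the image of the orbit chart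
`Ψ_t(X) = Ad((1+X⁺)(1+X⁻))(t + X_d)` (★ E1∕E2), `m ∈ K` an element normalising `A` (a permutation matrix: `Ad(m)(diagonal v)` is diagonal).  At a level `k` SEPARATING
the roots (`q^{-k} < ‖d_i − d_j‖` for `i ≠ j`):
* §1–§2 algebra ∕ valuations: conjugate diagonal matrices within `𝔭^k` of `t` are EQUAL; the centraliser of `s` is `A`; `y ∈ GL₃(F)` with `Ad(y) s ∈ V_k(t)` lies in
  `(1+X⁺)(1+X⁻)·A`; hence (`conj_mem_image_orbitChart_imp`) for `k' ∈ K`, `n ∈ N`: `Ad(k' n m) s ∈ V_k(t)` forces `n ∈ N(𝒪)` and then all off-diagonal entries of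
  `k' n m ∈ K` lie in `𝔭^k`.
* FILE G2 (`K2E3GL3KNOrbitalLocalPullback`) turns this into the measure statement `∫⁻_{K×N} (1_{V_k(t)}·h)(Ad(k' n m) s) = μN(N(𝒪)) · c · ∫⁻∫⁻ h(Ψ_t(U r + L r' + diagonal z))`
  over the level-`k` product formula (IMF) for `κ`.
HONEST LABEL: HC_CM is proved only modulo the 7 printed citations (2 remaining named inputs: hLiu418 = stmt-HodgeConjecture-24832, h413 = stmt-HodgeConjecture-24833)
until rung 0 closes; count-neutral helper ((LBGL-ge3)∕(LBGL-3J) NOT ★ here).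

## References
* [HarishChandra1999AdmissibleDistributions] Harish-Chandra (DeBacker–Sally), *Admissible Invariant Distributions on Reductive p-adic Groups* (1999), §7, Lemma 7.8.
* [HarishChandra1970] Harish-Chandra (van Dijk), *Harmonic Analysis on Reductive p-adic Groups*, LNM 162 (1970), Part V §4 Lemma 22.
* [BernsteinZelevinsky1976] I. N. Bernstein, A. V. Zelevinsky, *Representations of the group GL(n,F)*, Russian Math. Surveys 31:3 (1976), §3 (Iwahori factorisation).
-/

set_option autoImplicit false
set_option linter.dupNamespace false

noncomputable section

open MeasureTheory Measure Filter Topology Set Matrix ValuativeRel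
open scoped MatrixGroups NNReal ENNReal Valued
open Literature.NumberTheory.Automorphic Literature.NumberTheory.Automorphic.LocalFieldHaar
open Literature.NumberTheory.GaloisRepresentations Literature.NumberTheory.GaloisRepresentations.IsNonarchimedeanLocalField
open Summit.HodgeConjecture.HodgeConjecture.Cruxes.H413.K2E3GL3OrbitChartDeriv

namespace Summit.HodgeConjecture.HodgeConjecture.Cruxes.H413.K2E3GL3OrbitChartStabilisers

/-! ## §1  Algebra over a field: eigenvalues of conjugate diagonal matrices, the centraliser of a regular diagonal matrix -/

section Algebra

variable {R : Type*} [Field R]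

/-- If `g·diagonal u·g⁻¹ = g'·diagonal v·g'⁻¹` then every `v i` is some `u j` (equal characteristic polynomials `∏ (X − u_j) = ∏ (X − v_j)`, evaluated at `v i`).
[folklore] -/
theorem exists_eq_of_conj_diagonal_eq (g g' : GL (Fin 3) R) (u v : Fin 3 → R)
    (h : (g : Matrix (Fin 3) (Fin 3) R) * Matrix.diagonal u * ((g⁻¹ : GL (Fin 3) R) : Matrix (Fin 3) (Fin 3) R) =
      (g' : Matrix (Fin 3) (Fin 3) R) * Matrix.diagonal v * ((g'⁻¹ : GL (Fin 3) R) : Matrix (Fin 3) (Fin 3) R)) (i : Fin 3) :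
    ∃ j, v i = u j := by
  have hc : (Matrix.diagonal u).charpoly = (Matrix.diagonal v).charpoly := by
    rw [← charpoly_conj_units g (Matrix.diagonal u), ← charpoly_conj_units g' (Matrix.diagonal v), h]
  rw [Matrix.charpoly_diagonal, Matrix.charpoly_diagonal] at hc
  have hev : Polynomial.eval (v i) (∏ j, (Polynomial.X - Polynomial.C (u j))) = 0 := by
    rw [hc, Polynomial.eval_prod]
    exact Finset.prod_eq_zero (Finset.mem_univ i) (by simp)
  rw [Polynomial.eval_prod, Finset.prod_eq_zero_iff] at hev
  obtain ⟨j, -, hj⟩ := hev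
  exact ⟨j, by simpa [sub_eq_zero] using hj⟩

/-- **The centraliser of a regular diagonal matrix is the diagonal torus**: if `Y` commutes with `diagonal u`, `u` injective, then `Y` is diagonal. [folklore] -/
theorem apply_eq_zero_of_commute_diagonal {u : Fin 3 → R} (hu : Function.Injective u) {Y : Matrix (Fin 3) (Fin 3) R}
    (h : Y * Matrix.diagonal u = Matrix.diagonal u * Y) {i j : Fin 3} (hij : i ≠ j) : Y i j = 0 := by
  have h1 := congr_fun (congr_fun h i) j
  rw [Matrix.mul_diagonal, Matrix.diagonal_mul] at h1
  have h2 : (u j - u i) * Y i j = 0 := by rw [sub_mul, mul_comm (u j), h1, sub_self]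
  rcases mul_eq_zero.1 h2 with h3 | h3
  · exact absurd (hu (sub_eq_zero.1 h3)).symm hij
  · exact h3

/-- If `Ad(y) s = Ad(g) s` for a regular diagonal `s = diagonal u` then `g⁻¹ y` is DIAGONAL (it centralises `s`). [folklore] -/
theorem inv_mul_apply_eq_zero_of_conj_eq {u : Fin 3 → R} (hu : Function.Injective u) (y g : GL (Fin 3) R)
    (h : (y : Matrix (Fin 3) (Fin 3) R) * Matrix.diagonal u * ((y⁻¹ : GL (Fin 3) R) : Matrix (Fin 3) (Fin 3) R) =
      (g : Matrix (Fin 3) (Fin 3) R) * Matrix.diagonal u * ((g⁻¹ : GL (Fin 3) R) : Matrix (Fin 3) (Fin 3) R)) {i j : Fin 3} (hij : i ≠ j) :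
    (((g⁻¹ * y : GL (Fin 3) R)) : Matrix (Fin 3) (Fin 3) R) i j = 0 := by
  refine apply_eq_zero_of_commute_diagonal hu ?_ hij
  -- `g⁻¹ y s = s g⁻¹ y` ⟸ `y s y⁻¹ = g s g⁻¹`
  have hyinv : ((y⁻¹ : GL (Fin 3) R) : Matrix (Fin 3) (Fin 3) R) * (y : Matrix (Fin 3) (Fin 3) R) = 1 := by
    rw [← Units.val_mul, inv_mul_cancel, Units.val_one]
  have hginv : ((g⁻¹ : GL (Fin 3) R) : Matrix (Fin 3) (Fin 3) R) * (g : Matrix (Fin 3) (Fin 3) R) = 1 := by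
    rw [← Units.val_mul, inv_mul_cancel, Units.val_one]
  have h1 : (y : Matrix (Fin 3) (Fin 3) R) * Matrix.diagonal u =
      (g : Matrix (Fin 3) (Fin 3) R) * Matrix.diagonal u * ((g⁻¹ : GL (Fin 3) R) : Matrix (Fin 3) (Fin 3) R) * (y : Matrix (Fin 3) (Fin 3) R) := by
    rw [← h, Matrix.mul_assoc, Matrix.mul_assoc, hyinv, Matrix.mul_one]
  calc (((g⁻¹ * y : GL (Fin 3) R)) : Matrix (Fin 3) (Fin 3) R) * Matrix.diagonal u
      = ((g⁻¹ : GL (Fin 3) R) : Matrix (Fin 3) (Fin 3) R) * ((y : Matrix (Fin 3) (Fin 3) R) * Matrix.diagonal u) := by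
        rw [Units.val_mul, Matrix.mul_assoc]
    _ = ((g⁻¹ : GL (Fin 3) R) : Matrix (Fin 3) (Fin 3) R) * (g : Matrix (Fin 3) (Fin 3) R) * Matrix.diagonal u *
          (((g⁻¹ : GL (Fin 3) R) : Matrix (Fin 3) (Fin 3) R) * (y : Matrix (Fin 3) (Fin 3) R)) := by
        rw [h1]; simp only [Matrix.mul_assoc]
    _ = Matrix.diagonal u * (((g⁻¹ * y : GL (Fin 3) R)) : Matrix (Fin 3) (Fin 3) R) := by
        rw [hginv, Matrix.one_mul, Units.val_mul]

/-- The upper ∕ lower ∕ diagonal parts of `U r + L r' + diagonal z`. [folklore] -/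
theorem parts_of_coords (r r' z : Fin 3 → R) :
    (!![0, ((!![0, r 0, r 1; 0, 0, r 2; 0, 0, 0] : Matrix (Fin 3) (Fin 3) R) + !![0, 0, 0; r' 0, 0, 0; r' 1, r' 2, 0] + Matrix.diagonal z) 0 1,
          ((!![0, r 0, r 1; 0, 0, r 2; 0, 0, 0] : Matrix (Fin 3) (Fin 3) R) + !![0, 0, 0; r' 0, 0, 0; r' 1, r' 2, 0] + Matrix.diagonal z) 0 2;
        0, 0, ((!![0, r 0, r 1; 0, 0, r 2; 0, 0, 0] : Matrix (Fin 3) (Fin 3) R) + !![0, 0, 0; r' 0, 0, 0; r' 1, r' 2, 0] + Matrix.diagonal z) 1 2;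
        0, 0, 0] : Matrix (Fin 3) (Fin 3) R) = !![0, r 0, r 1; 0, 0, r 2; 0, 0, 0] ∧
    (!![0, 0, 0;
        ((!![0, r 0, r 1; 0, 0, r 2; 0, 0, 0] : Matrix (Fin 3) (Fin 3) R) + !![0, 0, 0; r' 0, 0, 0; r' 1, r' 2, 0] + Matrix.diagonal z) 1 0, 0, 0;
        ((!![0, r 0, r 1; 0, 0, r 2; 0, 0, 0] : Matrix (Fin 3) (Fin 3) R) + !![0, 0, 0; r' 0, 0, 0; r' 1, r' 2, 0] + Matrix.diagonal z) 2 0,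
        ((!![0, r 0, r 1; 0, 0, r 2; 0, 0, 0] : Matrix (Fin 3) (Fin 3) R) + !![0, 0, 0; r' 0, 0, 0; r' 1, r' 2, 0] + Matrix.diagonal z) 2 1, 0] : Matrix (Fin 3) (Fin 3) R) =
      !![0, 0, 0; r' 0, 0, 0; r' 1, r' 2, 0] ∧
    (fun i => ((!![0, r 0, r 1; 0, 0, r 2; 0, 0, 0] : Matrix (Fin 3) (Fin 3) R) + !![0, 0, 0; r' 0, 0, 0; r' 1, r' 2, 0] + Matrix.diagonal z) i i) = z := by
  refine ⟨?_, ?_, ?_⟩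
  · ext i j; fin_cases i <;> fin_cases j <;> simp
  · ext i j; fin_cases i <;> fin_cases j <;> simp
  · funext i; fin_cases i <;> simp

end Algebra


/-! ## §2  The local field: separation of the Weyl translates at level `k`, and WHO conjugates `s = diagonal (d + z)` into `V_k(t)` -/

section LocalField

variable {F : Type*} [Field F] [ValuativeRel F] [TopologicalSpace F] [IsNonarchimedeanLocalField F]

/-- **Separation at level `k`**: if `q^{-k} < ‖d_i − d_j‖` for `i ≠ j` and `z, x ∈ (𝔭^k)³`, then «every `d_i + x_i` is some `d_j + z_j`» forces `x = z`
(for `j ≠ i`, `‖d_i − d_j‖ = ‖z_j − x_i‖ ≤ q^{-k}`, absurd). [folklore] -/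
theorem eq_of_forall_exists_add_eq {d z x : Fin 3 → F} {k : ℕ}
    (hsep : ∀ i j, i ≠ j → ((residueFieldCard F : ℝ≥0)⁻¹) ^ (k : ℤ) < normAbs F (d i - d j))
    (hz : ∀ i, z i ∈ primePowBall F k) (hx : ∀ i, x i ∈ primePowBall F k)
    (h : ∀ i, ∃ j, d i + x i = d j + z j) : x = z := by
  funext i
  obtain ⟨j, hj⟩ := h i
  by_cases hij : i = j
  · subst hij; exact add_left_cancel hj
  · exfalso
    have h1 : d i - d j = z j + -x i := by rw [← sub_eq_add_neg]; linear_combination hj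
    have h2 : normAbs F (d i - d j) ≤ ((residueFieldCard F : ℝ≥0)⁻¹) ^ (k : ℤ) := by
      rw [h1]
      refine (normAbs_add_le_max _ _).trans (max_le ?_ ?_)
      · exact (mem_primePowBall_iff.1 (hz j))
      · rw [normAbs_neg]; exact (mem_primePowBall_iff.1 (hx i))
    exact absurd (hsep i j hij) (not_lt.2 h2)

/-- At a separating level, `d + z` is again injective (regular). [folklore] -/
theorem injective_add_of_sep {d z : Fin 3 → F} {k : ℕ}
    (hsep : ∀ i j, i ≠ j → ((residueFieldCard F : ℝ≥0)⁻¹) ^ (k : ℤ) < normAbs F (d i - d j))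
    (hz : ∀ i, z i ∈ primePowBall F k) : Function.Injective (d + z) := by
  intro i j hij
  by_contra hne
  have h1 : d i - d j = z j + -z i := by
    have := hij; simp only [Pi.add_apply] at this; rw [← sub_eq_add_neg]; linear_combination this
  have h2 : normAbs F (d i - d j) ≤ ((residueFieldCard F : ℝ≥0)⁻¹) ^ (k : ℤ) := by
    rw [h1]
    refine (normAbs_add_le_max _ _).trans (max_le (mem_primePowBall_iff.1 (hz j)) ?_)
    rw [normAbs_neg]; exact mem_primePowBall_iff.1 (hz i)
  exact absurd (hsep i j hne) (not_lt.2 h2)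

/-- **WHO CONJUGATES `s` INTO `V_k(t)`.**  Let `t = diagonal d` be separated at level `k`, `z ∈ (𝔭^k)³`, `s = diagonal (d + z)`, and `y ∈ GL₃(F)` with `Ad(y) s ∈ V_k(t) = Ψ_t(M₃(𝔭^k))`.
Then `Ad(y) s = Ψ_t(X)` for some `X ∈ M₃(𝔭^k)` WITH DIAGONAL PART `z`, and `y = (1+X⁺)(1+X⁻)·a` with `a` DIAGONAL (conjugate diagonals near `t` are equal; the centraliser of the
regular `s` is the torus). [cite: HarishChandra1999AdmissibleDistributions, Lemma 7.8] [cite: HarishChandra1970, Part V §4 Lemma 22] -/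
theorem exists_of_conj_mem_image_orbitChart (d : Fin 3 → F) {k : ℕ}
    (hsep : ∀ i j, i ≠ j → ((residueFieldCard F : ℝ≥0)⁻¹) ^ (k : ℤ) < normAbs F (d i - d j))
    (Ψ : Matrix (Fin 3) (Fin 3) F → Matrix (Fin 3) (Fin 3) F)
    (hΨ : Ψ = fun X : Matrix (Fin 3) (Fin 3) F =>
        (1 + !![0, X 0 1, X 0 2; 0, 0, X 1 2; 0, 0, 0]) * (1 + !![0, 0, 0; X 1 0, 0, 0; X 2 0, X 2 1, 0]) *
          (Matrix.diagonal d + Matrix.diagonal (fun i => X i i)) *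
          ((1 - !![0, 0, 0; X 1 0, 0, 0; X 2 0, X 2 1, 0] + !![0, 0, 0; X 1 0, 0, 0; X 2 0, X 2 1, 0] * !![0, 0, 0; X 1 0, 0, 0; X 2 0, X 2 1, 0]) *
            (1 - !![0, X 0 1, X 0 2; 0, 0, X 1 2; 0, 0, 0] + !![0, X 0 1, X 0 2; 0, 0, X 1 2; 0, 0, 0] * !![0, X 0 1, X 0 2; 0, 0, X 1 2; 0, 0, 0])))
    {z : Fin 3 → F} (hz : ∀ i, z i ∈ primePowBall F k) (y : GL (Fin 3) F)
    (hy : (y : Matrix (Fin 3) (Fin 3) F) * Matrix.diagonal (d + z) * ((y⁻¹ : GL (Fin 3) F) : Matrix (Fin 3) (Fin 3) F) ∈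
      Ψ '' {X : Matrix (Fin 3) (Fin 3) F | ∀ i j, X i j ∈ primePowBall F k}) :
    ∃ X : Matrix (Fin 3) (Fin 3) F, (∀ i j, X i j ∈ primePowBall F k) ∧ (fun i => X i i) = z ∧
      ∃ g : GL (Fin 3) F, (g : Matrix (Fin 3) (Fin 3) F) = (1 + !![0, X 0 1, X 0 2; 0, 0, X 1 2; 0, 0, 0]) * (1 + !![0, 0, 0; X 1 0, 0, 0; X 2 0, X 2 1, 0]) ∧
        Ψ X = (y : Matrix (Fin 3) (Fin 3) F) * Matrix.diagonal (d + z) * ((y⁻¹ : GL (Fin 3) F) : Matrix (Fin 3) (Fin 3) F) ∧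
        ∀ i j, i ≠ j → (((g⁻¹ * y : GL (Fin 3) F)) : Matrix (Fin 3) (Fin 3) F) i j = 0 := by
  obtain ⟨X, hX, hXy⟩ := hy
  obtain ⟨g, hg, hconj⟩ := exists_orbitChart_eq_conj d X
  have hΨX : Ψ X = (g : Matrix (Fin 3) (Fin 3) F) * Matrix.diagonal (d + fun i => X i i) * ((g⁻¹ : GL (Fin 3) F) : Matrix (Fin 3) (Fin 3) F) := by
    rw [hΨ]; exact hconj
  -- the diagonal part of `X` is `z`
  have hxz : (fun i => X i i) = z := by
    refine eq_of_forall_exists_add_eq hsep hz (fun i => hX i i) fun i => ?_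
    have h := exists_eq_of_conj_diagonal_eq y g (d + z) (d + fun i => X i i) (by rw [← hΨX, hXy]) i
    simpa only [Pi.add_apply] using h
  refine ⟨X, hX, hxz, g, hg, hXy, fun i j hij => ?_⟩
  refine inv_mul_apply_eq_zero_of_conj_eq (injective_add_of_sep hsep hz) y g ?_ hij
  rw [← hXy, hΨX, hxz]

omit [TopologicalSpace F] [IsNonarchimedeanLocalField F] in
/-- Entrywise integrality is stable under matrix products. [folklore] -/
theorem forall_mul_apply_mem_integer {A B : Matrix (Fin 3) (Fin 3) F} (hA : ∀ i j, A i j ∈ 𝒪[F]) (hB : ∀ i j, B i j ∈ 𝒪[F]) (i j : Fin 3) :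
    (A * B) i j ∈ 𝒪[F] := by
  rw [Matrix.mul_apply]; exact sum_mem fun l _ => mul_mem (hA i l) (hB l j)

/-- `𝔭^k · 𝒪 ⊆ 𝔭^k` entrywise under matrix products. [folklore] -/
theorem forall_mul_apply_mem_primePowBall {k : ℤ} {A B : Matrix (Fin 3) (Fin 3) F} (hA : ∀ i j, A i j ∈ primePowBall F k) (hB : ∀ i j, B i j ∈ 𝒪[F])
    (i j : Fin 3) : (A * B) i j ∈ primePowBall F k := by
  rw [Matrix.mul_apply]
  refine sum_mem_primePowBall _ fun l _ => ?_
  have h := mul_mem_primePowBall (hA i l) (mem_primePowBall_zero_iff.2 (hB l j))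
  rwa [add_zero] at h

/-- The entries of `X⁺`, `X⁻` lie in `𝔭^k` when those of `X` do. [folklore] -/
theorem forall_upper_lower_mem {k : ℤ} {X : Matrix (Fin 3) (Fin 3) F} (hX : ∀ i j, X i j ∈ primePowBall F k) :
    (∀ i j, (!![0, X 0 1, X 0 2; 0, 0, X 1 2; 0, 0, 0] : Matrix (Fin 3) (Fin 3) F) i j ∈ primePowBall F k) ∧
    (∀ i j, (!![0, 0, 0; X 1 0, 0, 0; X 2 0, X 2 1, 0] : Matrix (Fin 3) (Fin 3) F) i j ∈ primePowBall F k) := by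
  constructor <;> intro i j <;> fin_cases i <;> fin_cases j <;> simp [zero_mem_primePowBall, hX]

/-- The group part `(1+X⁺)(1+X⁻)` of the chart at an INTEGRAL `X` lies in `K = GL₃(𝒪)`, and its off-diagonal entries lie in `𝔭^k` when `X ∈ M₃(𝔭^k)` (`k ≥ 0`).
[folklore] -/
theorem mem_glInt_and_offDiag_of_box {k : ℕ} {X : Matrix (Fin 3) (Fin 3) F} (hX : ∀ i j, X i j ∈ primePowBall F k) (g : GL (Fin 3) F)
    (hg : (g : Matrix (Fin 3) (Fin 3) F) = (1 + !![0, X 0 1, X 0 2; 0, 0, X 1 2; 0, 0, 0]) * (1 + !![0, 0, 0; X 1 0, 0, 0; X 2 0, X 2 1, 0])) :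
    g ∈ glInt 3 F ∧ ∀ i j, i ≠ j → (g : Matrix (Fin 3) (Fin 3) F) i j ∈ primePowBall F k := by
  obtain ⟨hU, hL⟩ := forall_upper_lower_mem (k := (k : ℤ)) hX
  have hU0 : ∀ i j, (!![0, X 0 1, X 0 2; 0, 0, X 1 2; 0, 0, 0] : Matrix (Fin 3) (Fin 3) F) i j ∈ 𝒪[F] :=
    fun i j => mem_primePowBall_zero_iff.1 (primePowBall_antitone (Int.natCast_nonneg k) (hU i j))
  have hL0 : ∀ i j, (!![0, 0, 0; X 1 0, 0, 0; X 2 0, X 2 1, 0] : Matrix (Fin 3) (Fin 3) F) i j ∈ 𝒪[F] :=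
    fun i j => mem_primePowBall_zero_iff.1 (primePowBall_antitone (Int.natCast_nonneg k) (hL i j))
  have h1 : ∀ i j, (1 : Matrix (Fin 3) (Fin 3) F) i j ∈ 𝒪[F] := fun i j => by
    rw [Matrix.one_apply]; split_ifs <;> simp
  have hadd : ∀ {A B : Matrix (Fin 3) (Fin 3) F}, (∀ i j, A i j ∈ 𝒪[F]) → (∀ i j, B i j ∈ 𝒪[F]) → ∀ i j, (A + B) i j ∈ 𝒪[F] :=
    fun hA hB i j => add_mem (hA i j) (hB i j)
  have hsub : ∀ {A B : Matrix (Fin 3) (Fin 3) F}, (∀ i j, A i j ∈ 𝒪[F]) → (∀ i j, B i j ∈ 𝒪[F]) → ∀ i j, (A - B) i j ∈ 𝒪[F] :=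
    fun hA hB i j => sub_mem (hA i j) (hB i j)
  obtain ⟨g', hg', hg'inv⟩ := exists_unit_upper_lower X
  have hgg' : g = g' := Units.ext (by rw [hg, hg'])
  subst hgg'
  refine ⟨(mem_glInt_iff g).2 ⟨?_, ?_⟩, fun i j hij => ?_⟩
  · rw [hg]; exact forall_mul_apply_mem_integer (hadd h1 hU0) (hadd h1 hL0)
  · rw [hg'inv]
    exact forall_mul_apply_mem_integer (hadd (hsub h1 hL0) (forall_mul_apply_mem_integer hL0 hL0))
      (hadd (hsub h1 hU0) (forall_mul_apply_mem_integer hU0 hU0))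
  · have hexp : (g : Matrix (Fin 3) (Fin 3) F) = 1 + ((!![0, X 0 1, X 0 2; 0, 0, X 1 2; 0, 0, 0] : Matrix (Fin 3) (Fin 3) F) +
        !![0, 0, 0; X 1 0, 0, 0; X 2 0, X 2 1, 0] + !![0, X 0 1, X 0 2; 0, 0, X 1 2; 0, 0, 0] * !![0, 0, 0; X 1 0, 0, 0; X 2 0, X 2 1, 0]) := by
      rw [hg]; noncomm_ring
    rw [hexp, Matrix.add_apply, Matrix.one_apply_ne hij, zero_add, Matrix.add_apply, Matrix.add_apply]
    exact add_mem_primePowBall (add_mem_primePowBall (hU i j) (hL i j)) (forall_mul_apply_mem_primePowBall hU hL0 i j)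


omit [ValuativeRel F] [TopologicalSpace F] [IsNonarchimedeanLocalField F] in
/-- Diagonal entries of `n · a'` and `(n · a')⁻¹ = a'⁻¹ · n⁻¹` for `n` upper unitriangular and `a'` diagonal. [folklore] -/
theorem diag_apply_unipotent_mul_diagonal {n a' : GL (Fin 3) F} (hn : n ∈ unipotentRadicalGL F (id : Fin 3 → Fin 3))
    (ha' : ∀ i j, i ≠ j → (a' : Matrix (Fin 3) (Fin 3) F) i j = 0) (i : Fin 3) :
    ((n * a' : GL (Fin 3) F) : Matrix (Fin 3) (Fin 3) F) i i = (a' : Matrix (Fin 3) (Fin 3) F) i i ∧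
    (((n * a')⁻¹ : GL (Fin 3) F) : Matrix (Fin 3) (Fin 3) F) i i = ((a'⁻¹ : GL (Fin 3) F) : Matrix (Fin 3) (Fin 3) F) i i := by
  have hnd : ∀ g : GL (Fin 3) F, g ∈ unipotentRadicalGL F (id : Fin 3 → Fin 3) → (g : Matrix (Fin 3) (Fin 3) F) i i = 1 := by
    intro g hg
    rw [(K2E3GL3BorelUnipotentHaar.mem_borelUnipotentGL3_iff g).1 hg]
    fin_cases i <;> simp
  have ha'inv : ∀ l j, l ≠ j → ((a'⁻¹ : GL (Fin 3) F) : Matrix (Fin 3) (Fin 3) F) l j = 0 :=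
    (mem_standardLeviGL_id_iff _).1 (Subgroup.inv_mem _ ((mem_standardLeviGL_id_iff _).2 ha'))
  constructor
  · rw [Units.val_mul, Matrix.mul_apply, Finset.sum_eq_single i (fun l _ hl => by rw [ha' l i hl, mul_zero]) (fun h => absurd (Finset.mem_univ i) h),
      hnd n hn, one_mul]
  · rw [_root_.mul_inv_rev, Units.val_mul, Matrix.mul_apply, Finset.sum_eq_single i (fun l _ hl => by rw [ha'inv i l (Ne.symm hl), zero_mul])
      (fun h => absurd (Finset.mem_univ i) h), hnd n⁻¹ (Subgroup.inv_mem _ hn), mul_one]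

/-- **If `Ad(k' n m) s ∈ V_k(t)` with `k' ∈ K`, `n ∈ N₃(F)`, `m ∈ K` normalising the torus, then `n ∈ N₃(𝒪)`** (the unipotent coordinate is forced to be integral:
`n · (m a⁻¹ m⁻¹) = k'⁻¹ g m⁻¹ ∈ K` with `g = (1+X⁺)(1+X⁻) ∈ K`, `a` the diagonal defect, and an upper-triangular element of `K` has unit diagonal).
[cite: HarishChandra1999AdmissibleDistributions, Lemma 7.8] [cite: BernsteinZelevinsky1976, §3] -/
theorem mem_glInt_of_conj_mem_image_orbitChart (d : Fin 3 → F) {k : ℕ}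
    (hsep : ∀ i j, i ≠ j → ((residueFieldCard F : ℝ≥0)⁻¹) ^ (k : ℤ) < normAbs F (d i - d j))
    (Ψ : Matrix (Fin 3) (Fin 3) F → Matrix (Fin 3) (Fin 3) F)
    (hΨ : Ψ = fun X : Matrix (Fin 3) (Fin 3) F =>
        (1 + !![0, X 0 1, X 0 2; 0, 0, X 1 2; 0, 0, 0]) * (1 + !![0, 0, 0; X 1 0, 0, 0; X 2 0, X 2 1, 0]) *
          (Matrix.diagonal d + Matrix.diagonal (fun i => X i i)) *
          ((1 - !![0, 0, 0; X 1 0, 0, 0; X 2 0, X 2 1, 0] + !![0, 0, 0; X 1 0, 0, 0; X 2 0, X 2 1, 0] * !![0, 0, 0; X 1 0, 0, 0; X 2 0, X 2 1, 0]) *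
            (1 - !![0, X 0 1, X 0 2; 0, 0, X 1 2; 0, 0, 0] + !![0, X 0 1, X 0 2; 0, 0, X 1 2; 0, 0, 0] * !![0, X 0 1, X 0 2; 0, 0, X 1 2; 0, 0, 0])))
    {z : Fin 3 → F} (hz : ∀ i, z i ∈ primePowBall F k) {k' n m : GL (Fin 3) F} (hk' : k' ∈ glInt 3 F) (hn : n ∈ unipotentRadicalGL F (id : Fin 3 → Fin 3))
    (hm : m ∈ glInt 3 F) (hmA : ∀ a : GL (Fin 3) F, (∀ i j, i ≠ j → (a : Matrix (Fin 3) (Fin 3) F) i j = 0) →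
      ∀ i j, i ≠ j → ((m * a * m⁻¹ : GL (Fin 3) F) : Matrix (Fin 3) (Fin 3) F) i j = 0)
    (hy : ((k' * n * m : GL (Fin 3) F) : Matrix (Fin 3) (Fin 3) F) * Matrix.diagonal (d + z) * (((k' * n * m)⁻¹ : GL (Fin 3) F) : Matrix (Fin 3) (Fin 3) F) ∈
      Ψ '' {X : Matrix (Fin 3) (Fin 3) F | ∀ i j, X i j ∈ primePowBall F k}) :
    n ∈ glInt 3 F := by
  obtain ⟨X, hX, -, g, hg, -, ha⟩ := exists_of_conj_mem_image_orbitChart d hsep Ψ hΨ hz (k' * n * m) hy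
  obtain ⟨hgK, -⟩ := mem_glInt_and_offDiag_of_box hX g hg
  set a : GL (Fin 3) F := g⁻¹ * (k' * n * m) with ha_def
  have hainv : ∀ i j, i ≠ j → ((a⁻¹ : GL (Fin 3) F) : Matrix (Fin 3) (Fin 3) F) i j = 0 :=
    (mem_standardLeviGL_id_iff _).1 (Subgroup.inv_mem _ ((mem_standardLeviGL_id_iff _).2 ha))
  set a' : GL (Fin 3) F := m * a⁻¹ * m⁻¹ with ha'_def
  have ha' : ∀ i j, i ≠ j → (a' : Matrix (Fin 3) (Fin 3) F) i j = 0 := hmA a⁻¹ hainv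
  -- `n · a' = k'⁻¹ g m⁻¹ ∈ K`
  have hb : n * a' = k'⁻¹ * g * m⁻¹ := by rw [ha'_def, ha_def]; group
  have hbK : n * a' ∈ glInt 3 F := by rw [hb]; exact mul_mem (mul_mem (inv_mem hk') hgK) (inv_mem hm)
  -- the diagonal entries of `a'` are units of `𝒪`
  obtain ⟨hbint, hbinv⟩ := (mem_glInt_iff _).1 hbK
  have ha'K : a' ∈ glInt 3 F := by
    refine (mem_glInt_iff _).2 ⟨fun i j => ?_, fun i j => ?_⟩
    · by_cases hij : i = j
      · subst hij; rw [← (diag_apply_unipotent_mul_diagonal hn ha' i).1]; exact hbint i i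
      · rw [ha' i j hij]; exact zero_mem _
    · by_cases hij : i = j
      · subst hij; rw [← (diag_apply_unipotent_mul_diagonal hn ha' i).2]; exact hbinv i i
      · rw [(mem_standardLeviGL_id_iff _).1 (Subgroup.inv_mem _ ((mem_standardLeviGL_id_iff _).2 ha')) i j hij]; exact zero_mem _
  have hn' : n = (n * a') * a'⁻¹ := by group
  rw [hn']
  exact mul_mem hbK (inv_mem ha'K)

end LocalField



end Summit.HodgeConjecture.HodgeConjecture.Cruxes.H413.K2E3GL3OrbitChartStabilisers

end
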